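import Literature.IUT.HodgeTheaters.GlobalFrobenioidsCoricRigidityOfDivisors
import Literature.IUT.HodgeTheaters.GlobalFrobenioidsCyclotomeIsoOfLaws
import Literature.IUT.HodgeTheaters.GlobalFrobenioidsCyclotomeIsoOfIntegralLaws
import Literature.IUT.HodgeTheaters.GlobalFrobenioidsBaseIdentify
import Summits.ABC.IUTFork.Conditional.Layer5OfS
import Literature.IUT.HodgeTheaters.TemperedCoveringsCor23OfSpecialFibreAllLevels
import Literature.IUT.HodgeTheaters.StableCurveTemperedDataOfSpecialFibreCor25
import Literature.IUT.HodgeTheaters.TemperedCoveringsSubgraphClosures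
import Literature.IUT.HodgeTheaters.TemperedCoveringsCuspidalInertia
import Summits.ABC.IUTFork.Conditional.Layer5OfSData
import HarnessLib

/-!
# Layer-5 certificate, ADDITIVE PART v0.1 — node `IUTchI:Ex5.1(v)` (and the (iii)-clause E51/L11 of `IUTchI:Ex5.1(i)`)
# as CLOSED CONJUNCTS from LAW-INSTANCE BINDERS (director-abc (C2); LAYER5-CERT-SPEC v0 §3 (c); L5-d2 ruling (E1))

cert L5 v0.1 additive part: CONE +22 (1 FACT F-2571 · 21 LAW) binders over 17 data atoms ⊢ 8 closed conjuncts for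
LAYER5-CERT-NODES row 1116 `IUTchI:Ex5.1(v)` ([IUTchI] Ex 5.1 (v) pp.127–129) + 1 LAW binder ⊢ 1 conjunct for row 1112
sub-row E51/L11 ([IUTchI] Ex 5.1 (iii) p.125 l.50–57).  Author of record: abc-iut-w5-d110 (SUBDAG-IUTchI-Ex51 index
seat; probe `CertL5Ex51Probe.lean` 308c030026cb1f8e); single writer of the certificate modules: abc-iut-L5-d2.

Mochizuki, *Inter-universal Teichmüller theory I: construction of Hodge theaters*, kurims manuscript (May 2020)
[cite: Mochizuki2012] (D-0012 claim key; series status DISPUTED) [claim: Mochizuki2012, status: disputed].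
(Doc-only amendment, plan/L5/ERRATA-L5.tsv E-59: claim tags added to this header and to the four theorem docstrings;
no statement or proof byte changed.)

HONEST FRAMING: nothing in this file asserts that abc is proved or refuted or takes a side on [IUTchIII] Cor. 3.12
(nor on [IUTchI]); every binder is an ASSUMPTION LABEL (a law instance at the genuine object — the reconstruction
output `N : NFBridgeRecon` = [AbsTopIII] Thm 1.9 merge, the Kummer container/realisations = L2 Kummer-map merge,
GAP G-w4d056-2 / G-w4d057g4-1); every conjunct is a CLOSED statement obtained by applying a LANDED closer BY NAME:
p424116 `NFBridgeRecon.existsUniqueCoricStructure_infκPair_of_divisors` / `…_infκxPair_of_divisors` (abc-iut-w4-d056),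
p424820 `UniqueCyclotomeIso.of_laws` (abc-iut-w5-d110), p427568 `UniqueCyclotomeIsoFamily.of_integral_laws`
(abc-iut-w4-d057), p413972 `NFBridgeRecon.IsCoricStructure.factorsThrough_ratKsolKer` / `…not_factorsThrough_ratKsolKer` /
`IsCoricStructure.existsUnique_iso` (abc-iut-w5-d110), p407751 `NFBridgeRecon.minfκUnits_subset` (abc-iut-L5-t1),
p414435 `GlobalFrobenioid.identify_unique` (abc-iut-w5-d110).  typed ≠ discharged; S-FREE (no [IUTchI] node consumes
`Cor312.PilotKummerIndRelated`).  PROOF-ONLY: no `def`, no `instance`, no `axiom`, no `sorry`, no `notation`.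
Post-freeze-additive modules cited: p424116, p424820, p427568 (all proof-only).

NOT TYPABLE at v0.1 (no conjunct): E51/L30 equality `InfκxUnitsEqConstants` (F-2575; model form p425080 only),
E51/L31 `DeterminesInfκStructure`, E51/L32 `ModSolReconstruction.RecoversModel` (F-2579), E51/L33 `PrimeLabelling`
(data), E51/L34 (L4-t2 objects), E51/L07 `KappaSolConjugateSynchronization` (F-2574, BLOCKED-vocab), E51/L04
`MκIsInvariants` (F-2571 — enters as the FACT binder `hF_2571`; model form `KappaCoricGaloisInvariantsProofs`).
-/

namespace Summit.ABC.IUTFork.Conditional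

open CategoryTheory Literature.IUT.HodgeTheaters ProfiniteGrp ProfiniteGrp.ProfiniteCompletion
open Literature.AnabelianGeometry.EtaleTheta Literature.AnabelianGeometry.EtaleTheta.ZHatLevel

universe u v w'

/-- **Row 1112, sub-row E51/L11** (class (c)) ((iii) p.125 l.50–57 "uniquely determined, in
light of the F-coricity of `C_F`, together with [AbsTopIII], Theorem 1.9"): binder `BaseCatRigid G` at
`G := π₁(†𝒟^⊛)`; closer abc-iut-w5-d110 p414435 `GlobalFrobenioid.identify_unique`.
[cite: Mochizuki2012, IUTchI Ex 5.1 (iii) p.125] [claim: Mochizuki2012, status: disputed] -/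
theorem layer5_held_ex51i_L11 {G : ProfiniteGrp.{u}} {Δ : GlobalDivisorData G} {Dcirc : Type (u + 1)}
    [CategoryTheory.Category.{u} Dcirc] {toBase0 : CategoryTheory.Functor Dcirc (BaseCat G)}
    (F : GlobalFrobenioid Δ Dcirc toBase0)
    (h_Ex51i_BaseCatRigid : BaseCatRigid G) :
    ∀ I' : CategoryTheory.Equivalence F.Base (BaseCat G), Nonempty (I'.functor ≅ F.identify.functor) :=
  fun I' => GlobalFrobenioid.identify_unique F h_Ex51i_BaseCatRigid I'

/-- **Row 1116, node `IUTchI:Ex5.1(v)`** (class (c)) ([IUTchI] Ex 5.1 (v) pp.127–129), CLOSED CONJUNCTS from LAW-INSTANCE BINDERS.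
Data binders: the reconstruction output `N` (L4 [AbsTopIII] Thm 1.9 merge), a Kummer container `H` with its
`π₁^rat`- and `Ẑ^×`-actions and the Kummer realisations `κ`/`κx` of the two model pairs (L2 Kummer-map merge,
GAP G-w4d056-2), an order map `ord` ([AbsTopIII] Prop 1.6 (iii)), the cyclotome comparison data `C` (∞κ case)
and `Cf` (`†𝕄^⊛` case with layers `⊛/sol/mod` and integral submonoids `𝒪^⊿_𝔭`).
Law binders: F-2571 `MκIsInvariants`; (a) Kummer naturality; (b′) divisor transport; Rmk 3.1.7 (i)/(ii)
pole/zero shape; (E)(T)(D)+Rmk 3.1.7 for `C`; (E)(T)(V)(I)(P) for `Cf`.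
Closers OF RECORD: p424116 `existsUniqueCoricStructure_infκPair_of_divisors` / `…_infκxPair_of_divisors`
(w4-d056), p424820 `UniqueCyclotomeIso.of_laws` (w5-d110), p427568 `UniqueCyclotomeIsoFamily.of_integral_laws`
(w4-d057), p413972 `IsCoricStructure.factorsThrough_ratKsolKer` / `IsCoricStructure.existsUnique_iso`
(w5-d110, unconditional).
[cite: Mochizuki2012, IUTchI Ex 5.1 (v) pp.127–129] [claim: Mochizuki2012, status: disputed] -/
theorem layer5_held_ex51v (N : NFBridgeRecon.{u})
    -- FACT binder (F-2571, [IUTchI] Ex 5.1 (i) p.124): `𝕄^⊛_κ` = the `π₁^rat`-invariants of `𝕄^⊛_∞κ`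
    (hF_2571 : N.MκIsInvariants)
    -- DATA: Kummer container and realisations of the two model pairs (L2 Kummer-map merge)
    (H : Type u) [CommGroup H] [MulAction N.piRat H]
    [MulAction (MulAut (completion (GrpCat.of (Multiplicative ℤ)))) H]
    (κ : N.infκPair.KummerRealization H) (κx : N.infκxPair.KummerRealization H)
    -- LAW (a) Kummer naturality, both pairs ([IUTchI] Ex 5.1 (v) p.127 l.76 – p.128 l.2)
    (h_Ex51v_nat : ∀ e : CoricPair.Iso N.infκPair N.infκPair,
      ∃ u : MulAut (completion (GrpCat.of (Multiplicative ℤ))),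
        ∀ x : N.infκPair.carrier, κ.toFun (e.toEquiv x) = u • κ.toFun x)
    (h_Ex51v_natx : ∀ e : CoricPair.Iso N.infκxPair N.infκxPair,
      ∃ u : MulAut (completion (GrpCat.of (Multiplicative ℤ))),
        ∀ x : N.infκxPair.carrier, κx.toFun (e.toEquiv x) = u • κx.toFun x)
    -- DATA: orders at points ([AbsTopIII] Prop 1.6 (iii))
    {X : Type v} (ord : X → N.Krat → ℤ)
    -- LAW (b′) divisor transport, both pairs
    (h_Ex51v_ord : ∀ (u : MulAut (completion (GrpCat.of (Multiplicative ℤ)))) (f f' : N.infκPair.carrier),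
      (f : N.Krat) ∈ N.Mκ → (f' : N.Krat) ∈ N.Mκ → κ.toFun f' = u • κ.toFun f →
      ∀ x : X, u (eta (ord x f)) = eta (ord x f'))
    (h_Ex51v_ordx : ∀ (u : MulAut (completion (GrpCat.of (Multiplicative ℤ)))) (f f' : N.infκxPair.carrier),
      (∀ g : N.piRat, g • (f : N.Krat) = f) → (∀ g : N.piRat, g • (f' : N.Krat) = f') →
      κx.toFun f' = u • κx.toFun f → ∀ x : X, u (eta (ord x f)) = eta (ord x f'))
    -- LAW Rmk 3.1.7 (i)/(ii): pole/zero shape of κ-coric / invariant ∞κ×-coric functions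
    (h_Ex51v_pole : ∀ f' ∈ N.Mκ, ∀ x₁ x₂ : X, x₁ ≠ x₂ → ¬ (ord x₁ f' < 0 ∧ ord x₂ f' < 0))
    (h_Ex51v_zero : ∃ f ∈ N.Mκ, ∃ x₁ x₂ : X, x₁ ≠ x₂ ∧ 0 < ord x₁ f ∧ 0 < ord x₂ f)
    (h_Ex51v_polex : ∀ f' ∈ N.Minfκx, (∀ g : N.piRat, g • f' = f') →
      ∀ x₁ x₂ : X, x₁ ≠ x₂ → ¬ (ord x₁ f' < 0 ∧ ord x₂ f' < 0))
    (h_Ex51v_zerox : ∃ f ∈ N.Minfκx, (∀ g : N.piRat, g • f = f) ∧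
      ∃ x₁ x₂ : X, x₁ ≠ x₂ ∧ 0 < ord x₁ f ∧ 0 < ord x₂ f)
    -- LAW Rmk 3.1.7 (ii)/(iii) for E51/L23: `π₁^{rat/κ-sol}` moves some ∞κ×-coric function (a constant)
    (h_Ex51v_moves : ∃ g ∈ N.ratKsolKer, ∃ f ∈ N.Minfκx, g • f ≠ f)
    -- DATA + LAWS for E51/L27 (∞κ cyclotome comparison): (E)(T)(D) + Rmk 3.1.7
    (C : CyclotomeComparison.{u})
    (zμ : MulAut (completion (GrpCat.of (Multiplicative ℤ))) → (C.μ₁ ≃* C.μ₂) → (C.μ₁ ≃* C.μ₂))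
    (h_Ex51v_zμ_one : ∀ e, zμ 1 e = e)
    (twist : MulAut (completion (GrpCat.of (Multiplicative ℤ))) → C.H₂ → C.H₂)
    (h_Ex51v_E : ∃ e₀ : C.μ₁ ≃* C.μ₂, Set.BijOn (C.induced e₀) C.im₁ C.im₂)
    (h_Ex51v_T : ∀ e e' : C.μ₁ ≃* C.μ₂, ∃ u : MulAut (completion (GrpCat.of (Multiplicative ℤ))),
      e' = zμ u e ∧ ∀ h, C.induced e' h = twist u (C.induced e h))
    {Pt : Type v} (ordC : Pt → C.H₂ → ℤ)
    (h_Ex51v_D : ∀ u : MulAut (completion (GrpCat.of (Multiplicative ℤ))), Set.MapsTo (twist u) C.im₂ C.im₂ →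
      ∀ h ∈ C.im₂, ∀ x : Pt, u (eta (ordC x h)) = eta (ordC x (twist u h)))
    (h_Ex51v_Ctwo : ∃ h ∈ C.im₂, ∃ x₁ x₂ : Pt, x₁ ≠ x₂ ∧ 0 < ordC x₁ h ∧ 0 < ordC x₂ h)
    (h_Ex51v_Cone : ∀ h ∈ C.im₂, ∀ x₁ x₂ : Pt, x₁ ≠ x₂ → ¬ (ordC x₁ h < 0 ∧ ordC x₂ h < 0))
    -- DATA + LAWS for E51/L28 (`†𝕄^⊛` display, layers ⊛/sol/mod, integral submonoids): (E)(T)(V)(I)(P)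
    {𝔓 : Type w'} (Cf : CyclotomeComparisonFamily AstLayer 𝔓)
    (zμf : MulAut (completion (GrpCat.of (Multiplicative ℤ))) → (Cf.μ₁ ≃* Cf.μ₂) → (Cf.μ₁ ≃* Cf.μ₂))
    (h_Ex51v_zμf_one : ∀ e, zμf 1 e = e)
    (twistf : MulAut (completion (GrpCat.of (Multiplicative ℤ))) → Cf.H₂ → Cf.H₂)
    (h_Ex51v_fE : ∃ e, Cf.InducesCompatibleIsos e)
    (h_Ex51v_fT : ∀ e e' : Cf.μ₁ ≃* Cf.μ₂, ∃ u : MulAut (completion (GrpCat.of (Multiplicative ℤ))),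
      e' = zμf u e ∧ ∀ h, Cf.induced e' h = twistf u (Cf.induced e h))
    (val : 𝔓 → Cf.H₂ → ℤ)
    (h_Ex51v_fV : ∀ u : MulAut (completion (GrpCat.of (Multiplicative ℤ))),
      Set.MapsTo (twistf u) (Cf.im₂ AstLayer.mod) (Cf.im₂ AstLayer.mod) →
        ∀ h ∈ Cf.im₂ AstLayer.mod, ∀ 𝔭 : 𝔓, u (eta (val 𝔭 h)) = eta (val 𝔭 (twistf u h)))
    (h_Ex51v_fI : ∀ 𝔭 : 𝔓, ∀ h ∈ Cf.im₂ AstLayer.mod, h ∈ Cf.int₂ 𝔭 → 0 ≤ val 𝔭 h)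
    (h_Ex51v_fP : ∃ 𝔭₀ : 𝔓, ∃ h ∈ Cf.im₂ AstLayer.mod, h ∈ Cf.int₂ 𝔭₀ ∧ 0 < val 𝔭₀ h) :
    -- CLOSED CONJUNCTS of node IUTchI:Ex5.1(v)
    ExistsUniqueCoricStructure N.piRat N.infκPair ∧                       -- E51/L29 (∞κ)
    ExistsUniqueCoricStructure N.piRat N.infκxPair ∧                      -- E51/L29 (∞κ×)
    UniqueCyclotomeIso C ∧                                                -- E51/L27
    UniqueCyclotomeIsoFamily Cf ∧                                         -- E51/L28
    (∀ P : CoricPair N.piRat, IsCoricStructure N.piRat N.infκPair P →     -- E51/L22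
      P.FactorsThrough N.ratKsolKer) ∧
    (∀ P : CoricPair N.piRat, IsCoricStructure N.piRat N.infκxPair P →    -- E51/L23
      ¬ P.FactorsThrough N.ratKsolKer) ∧
    (∀ P P' : CoricPair N.piRat, ∀ (h : IsCoricStructure N.piRat N.infκPair P) -- E51/L26+L29, 2 structures
      (h' : IsCoricStructure N.piRat N.infκPair P'),
      ∃! e : CoricPair.Iso P P',
        e.IsCompatible (CoricPair.KummerRealization.ofIso h.nonempty_iso.some κ)
          (CoricPair.KummerRealization.ofIso h'.nonempty_iso.some κ)) ∧
    N.minfκUnits ⊆ N.minfκxUnits :=                                      -- E51/L30 (unconditional)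
  ⟨N.existsUniqueCoricStructure_infκPair_of_divisors hF_2571 κ h_Ex51v_nat ord h_Ex51v_ord h_Ex51v_pole
      h_Ex51v_zero,
    N.existsUniqueCoricStructure_infκxPair_of_divisors κx h_Ex51v_natx ord h_Ex51v_ordx h_Ex51v_polex
      h_Ex51v_zerox,
    UniqueCyclotomeIso.of_laws C zμ h_Ex51v_zμ_one twist h_Ex51v_E h_Ex51v_T ordC h_Ex51v_D h_Ex51v_Ctwo
      h_Ex51v_Cone,
    UniqueCyclotomeIsoFamily.of_integral_laws Cf AstLayer.mod zμf h_Ex51v_zμf_one twistf h_Ex51v_fE h_Ex51v_fT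
      val h_Ex51v_fV h_Ex51v_fI h_Ex51v_fP,
    fun _ h => NFBridgeRecon.IsCoricStructure.factorsThrough_ratKsolKer N h,
    fun _ h => NFBridgeRecon.IsCoricStructure.not_factorsThrough_ratKsolKer N h h_Ex51v_moves,
    fun _ _ h h' => IsCoricStructure.existsUnique_iso κ h h',
    N.minfκUnits_subset⟩

section Sec2Reduced

open scoped Pointwise
open Topology Literature.AnabelianGeometry.SemiGraphs

/-- **v0.1: [IUTchI] §2 held rows with the REDUCED binder set** (abc-iut-L5-d5's `cor23_i_to_iv_ofSpecialFibre_reduced`,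
`TemperedCoveringsCor23OfSpecialFibreAllLevels.lean`, banked by abc-iut-L5-lead RULINGS #40 (1)(c)): same conjuncts as
`layer5_held_sec2` of `Conditional/Layer5OfS.lean`, with the level family `J`/`hcof` replaced by the `J`-FREE KER-LEVEL conclusions
`hA'`/`hB'` at EVERY normal open `W ⊆ Δ̂_X` (equivalent: `kerLevel_all_of_cofinal` / `kerLevel_cofinal_of_all`) and the profinite
outer-descent atom `hOutHat` DERIVED (`outerHat_of_outerTp` + Cor 2.3 (ii)).  Law binders: h22 · hH · hker · hOutTp · hA' · hB' · hv ·
htp · hhat · h24i · h24ii = 11 (v0: 13).  Nothing here asserts that abc is proved or refuted or takes a side on [IUTchIII] Cor. 3.12;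
a binder is an assumption label; typed ≠ discharged.
[cite: Mochizuki2012, IUTchI Cor 2.3 p.47, Prop 2.4 p.50, Cor 2.5 p.51] [claim: Mochizuki2012, status: disputed] -/
theorem layer5_held_sec2_v1
    {p : ℕ} [Fact p.Prime] (X : Literature.AnabelianGeometry.SemiGraphs.TemperedCurve p) (d : X.GroupLevelData)
    (S : Literature.AnabelianGeometry.SemiGraphs.SpecialFibreData (X.toTemperedArithmeticGroup d)) (h36 : S.Gc.Prop36Hypotheses)
    (Sigma SigmaHat : Set ℕ) (hsub : Sigma ⊆ SigmaHat) (hne : Sigma.Nonempty)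
    (hprime : ∀ q ∈ SigmaHat, q.Prime) (hp : p ∉ Sigma) (TpH : Subgroup S.chart.G)
    (HatH : Subgroup (TemperedGraphGroupData.exists_completion_of_prop36 S.Gc h36 S.chart).choose)
    (hle : TpH.map (TemperedGraphGroupData.exists_completion_of_prop36 S.Gc h36
      S.chart).choose_spec.choose.toMonoidHom ≤ HatH)
    (cuspMeetsH : {x : X.Pt // X.IsCusp x} → Prop) (x : {x : X.Pt // X.IsCusp x})
    (h22 : (StableCurveTemperedData.ofSpecialFibre X d S h36 Sigma SigmaHat hsub hne hprime hp TpH HatH hle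
      cuspMeetsH).graph.CommensuratorsOfDecompositionSubgroups)
    (hH : ((StableCurveTemperedData.ofSpecialFibre X d S h36 Sigma SigmaHat hsub hne hprime hp TpH HatH hle cuspMeetsH).graph.HatH :
        Set (StableCurveTemperedData.ofSpecialFibre X d S h36 Sigma SigmaHat hsub hne hprime hp TpH HatH hle cuspMeetsH).graph.Hat) =
      closure ((StableCurveTemperedData.ofSpecialFibre X d S h36 Sigma SigmaHat hsub hne hprime hp TpH HatH hle cuspMeetsH).graph.ι ''
        (StableCurveTemperedData.ofSpecialFibre X d S h36 Sigma SigmaHat hsub hne hprime hp TpH HatH hle cuspMeetsH).graph.TpH))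
    (hker : ((StableCurveTemperedData.ofSpecialFibre X d S h36 Sigma SigmaHat hsub hne hprime hp TpH HatH hle cuspMeetsH).ρHat.ker :
        Set (StableCurveTemperedData.ofSpecialFibre X d S h36 Sigma SigmaHat hsub hne hprime hp TpH HatH hle cuspMeetsH).DeltaHat) ⊆
      closure (((StableCurveTemperedData.ofSpecialFibre X d S h36 Sigma SigmaHat hsub hne hprime hp TpH HatH hle cuspMeetsH).ιΔ.range :
          Set (StableCurveTemperedData.ofSpecialFibre X d S h36 Sigma SigmaHat hsub hne hprime hp TpH HatH hle cuspMeetsH).DeltaHat) ∩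
        ((StableCurveTemperedData.ofSpecialFibre X d S h36 Sigma SigmaHat hsub hne hprime hp TpH HatH hle cuspMeetsH).ρHat.ker :
          Set (StableCurveTemperedData.ofSpecialFibre X d S h36 Sigma SigmaHat hsub hne hprime hp TpH HatH hle cuspMeetsH).DeltaHat)))
    (hOutTp : ∀ g : (StableCurveTemperedData.ofSpecialFibre X d S h36 Sigma SigmaHat hsub hne hprime hp TpH HatH hle cuspMeetsH).PiTp,
      ∃ δ : (StableCurveTemperedData.ofSpecialFibre X d S h36 Sigma SigmaHat hsub hne hprime hp TpH HatH hle cuspMeetsH).DeltaTp,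
        MulAut.conj g • ((StableCurveTemperedData.ofSpecialFibre X d S h36 Sigma SigmaHat hsub hne hprime hp TpH HatH hle
            cuspMeetsH).deltaTpH.map
          (StableCurveTemperedData.ofSpecialFibre X d S h36 Sigma SigmaHat hsub hne hprime hp TpH HatH hle cuspMeetsH).DeltaTp.subtype) =
        MulAut.conj (δ : (StableCurveTemperedData.ofSpecialFibre X d S h36 Sigma SigmaHat hsub hne hprime hp TpH HatH hle
            cuspMeetsH).PiTp) •
          ((StableCurveTemperedData.ofSpecialFibre X d S h36 Sigma SigmaHat hsub hne hprime hp TpH HatH hle cuspMeetsH).deltaTpH.map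
            (StableCurveTemperedData.ofSpecialFibre X d S h36 Sigma SigmaHat hsub hne hprime hp TpH HatH hle cuspMeetsH).DeltaTp.subtype))
    (hA' : (∃ l ∈ SigmaHat, l ∉ Sigma ∧ l ≠ p) →
      ∀ W : Subgroup (StableCurveTemperedData.ofSpecialFibre X d S h36 Sigma SigmaHat hsub hne hprime hp TpH HatH hle cuspMeetsH).DeltaHat,
        W.Normal → IsOpen (W : Set (StableCurveTemperedData.ofSpecialFibre X d S h36 Sigma SigmaHat hsub hne hprime hp TpH HatH hle
          cuspMeetsH).DeltaHat) →
        ∀ a : (StableCurveTemperedData.ofSpecialFibre X d S h36 Sigma SigmaHat hsub hne hprime hp TpH HatH hle cuspMeetsH).DeltaHat,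
          (∀ x ∈ W, x ∈ (StableCurveTemperedData.ofSpecialFibre X d S h36 Sigma SigmaHat hsub hne hprime hp TpH HatH hle
            cuspMeetsH).ρHat.ker → a * x = x * a) → a ∈ W)
    (hB' : SigmaHat = {q | q.Prime} →
      ∀ W : Subgroup (StableCurveTemperedData.ofSpecialFibre X d S h36 Sigma SigmaHat hsub hne hprime hp TpH HatH hle cuspMeetsH).DeltaHat,
        W.Normal → IsOpen (W : Set (StableCurveTemperedData.ofSpecialFibre X d S h36 Sigma SigmaHat hsub hne hprime hp TpH HatH hle
          cuspMeetsH).DeltaHat) →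
        ∀ a : (StableCurveTemperedData.ofSpecialFibre X d S h36 Sigma SigmaHat hsub hne hprime hp TpH HatH hle cuspMeetsH).DeltaHat,
          (∀ x ∈ W, x ∈ (StableCurveTemperedData.ofSpecialFibre X d S h36 Sigma SigmaHat hsub hne hprime hp TpH HatH hle
            cuspMeetsH).ρHat.ker → a * x = x * a) → a ∈ W)
    (hv : ((StableCurveTemperedData.ofSpecialFibre X d S h36 Sigma SigmaHat hsub hne hprime hp TpH HatH hle cuspMeetsH).graph.HatH : Set (StableCurveTemperedData.ofSpecialFibre X d S h36 Sigma SigmaHat hsub hne hprime hp TpH HatH hle cuspMeetsH).graph.Hat) ∩ Set.range (StableCurveTemperedData.ofSpecialFibre X d S h36 Sigma SigmaHat hsub hne hprime hp TpH HatH hle cuspMeetsH).graph.ι =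
      (StableCurveTemperedData.ofSpecialFibre X d S h36 Sigma SigmaHat hsub hne hprime hp TpH HatH hle cuspMeetsH).graph.ι '' (StableCurveTemperedData.ofSpecialFibre X d S h36 Sigma SigmaHat hsub hne hprime hp TpH HatH hle cuspMeetsH).graph.TpH)
    (htp : ∀ x : (StableCurveTemperedData.ofSpecialFibre X d S h36 Sigma SigmaHat hsub hne hprime hp TpH HatH hle cuspMeetsH).Cusp, (StableCurveTemperedData.ofSpecialFibre X d S h36 Sigma SigmaHat hsub hne hprime hp TpH HatH hle cuspMeetsH).cuspMeetsH x →
      ∃ t : (StableCurveTemperedData.ofSpecialFibre X d S h36 Sigma SigmaHat hsub hne hprime hp TpH HatH hle cuspMeetsH).graph.Tp, ((StableCurveTemperedData.ofSpecialFibre X d S h36 Sigma SigmaHat hsub hne hprime hp TpH HatH hle cuspMeetsH).inertiaTp x).map (StableCurveTemperedData.ofSpecialFibre X d S h36 Sigma SigmaHat hsub hne hprime hp TpH HatH hle cuspMeetsH).ρTp ≤ MulAut.conj t • (StableCurveTemperedData.ofSpecialFibre X d S h36 Sigma SigmaHat hsub hne hprime hp TpH HatH hle cuspMeetsH).graph.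TpH)
    (hhat : ∀ x : (StableCurveTemperedData.ofSpecialFibre X d S h36 Sigma SigmaHat hsub hne hprime hp TpH HatH hle cuspMeetsH).Cusp,
      (∃ g : (StableCurveTemperedData.ofSpecialFibre X d S h36 Sigma SigmaHat hsub hne hprime hp TpH HatH hle cuspMeetsH).graph.Hat, (((StableCurveTemperedData.ofSpecialFibre X d S h36 Sigma SigmaHat hsub hne hprime hp TpH HatH hle cuspMeetsH).inertiaTp x).map (StableCurveTemperedData.ofSpecialFibre X d S h36 Sigma SigmaHat hsub hne hprime hp TpH HatH hle cuspMeetsH).ρTp).map (StableCurveTemperedData.ofSpecialFibre X d S h36 Sigma SigmaHat hsub hne hprime hp TpH HatH hle cuspMeetsH).graph.ι ≤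
        MulAut.conj g • (StableCurveTemperedData.ofSpecialFibre X d S h36 Sigma SigmaHat hsub hne hprime hp TpH HatH hle cuspMeetsH).graph.HatH) → (StableCurveTemperedData.ofSpecialFibre X d S h36 Sigma SigmaHat hsub hne hprime hp TpH HatH hle cuspMeetsH).cuspMeetsH x)
    (h24i : (StableCurveTemperedData.ofSpecialFibre X d S h36 Sigma SigmaHat hsub hne hprime hp TpH HatH hle cuspMeetsH).Prop24i)
    (h24ii : (StableCurveTemperedData.ofSpecialFibre X d S h36 Sigma SigmaHat hsub hne hprime hp TpH HatH hle cuspMeetsH).Prop24ii) :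
    (StableCurveTemperedData.ofSpecialFibre X d S h36 Sigma SigmaHat hsub hne hprime hp TpH HatH hle cuspMeetsH).Cor23i ∧ (StableCurveTemperedData.ofSpecialFibre X d S h36 Sigma SigmaHat hsub hne hprime hp TpH HatH hle cuspMeetsH).Cor23ii ∧ (StableCurveTemperedData.ofSpecialFibre X d S h36 Sigma SigmaHat hsub hne hprime hp TpH HatH hle cuspMeetsH).Cor23iii ∧ (StableCurveTemperedData.ofSpecialFibre X d S h36 Sigma SigmaHat hsub hne hprime hp TpH HatH hle cuspMeetsH).Cor23iv ∧ (StableCurveTemperedData.ofSpecialFibre X d S h36 Sigma SigmaHat hsub hne hprime hp TpH HatH hle cuspMeetsH).Cor23v ∧ (StableCurveTemperedData.ofSpecialFibre X d S h36 Sigma SigmaHat hsub hne hprime hp TpH HatH hle cuspMeetsH).Cor23vi ∧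
    ((StableCurveTemperedData.ofSpecialFibre X d S h36 Sigma SigmaHat hsub hne hprime hp TpH HatH hle cuspMeetsH).Cor25Decomposition ∧ (StableCurveTemperedData.ofSpecialFibre X d S h36 Sigma SigmaHat hsub hne hprime hp TpH HatH hle cuspMeetsH).Cor25Inertia) ∧ (StableCurveTemperedData.ofSpecialFibre X d S h36 Sigma SigmaHat hsub hne hprime hp TpH HatH hle cuspMeetsH).Prop24iii :=
  haveI : Nonempty X.Pt := ⟨x.1⟩
  haveI : Nonempty {x : X.Pt // X.IsCusp x} := ⟨x⟩
  have h14 := StableCurveTemperedData.cor23_i_to_iv_ofSpecialFibre_reduced X d S h36 Sigma SigmaHat hsub hne hprime hp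
    TpH HatH hle cuspMeetsH h22 hH hker hOutTp hA' hB'
  ⟨h14.1, h14.2.1, h14.2.2.1, h14.2.2.2, (StableCurveTemperedData.ofSpecialFibre X d S h36 Sigma SigmaHat hsub hne hprime hp TpH HatH hle cuspMeetsH).cor23v_of_graph hv,
    (StableCurveTemperedData.ofSpecialFibre X d S h36 Sigma SigmaHat hsub hne hprime hp TpH HatH hle cuspMeetsH).cor23vi_of_graph htp hhat,
    StableCurveTemperedData.cor25_ofSpecialFibre X d S h36 Sigma SigmaHat hsub hne hprime hp TpH HatH hle cuspMeetsH h24i h24ii,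
    StableCurveTemperedData.prop24iii_ofSpecialFibre X d S h36 Sigma SigmaHat hsub hne hprime hp TpH HatH hle cuspMeetsH x h24i⟩

end Sec2Reduced

/-- **THE LAYER-5 CERTIFICATE v1 — SINGLE TOP OF RECORD** (abc-iut-L5-lead RULINGS #40 (1)(b) and 06:59:06Z (4)): the conjunction,
BY NAME via `StatementOf`, of the v0 top `layer5_of_S` (`Conditional/Layer5OfS.lean`: the four DISCHARGED-section statements and the
held rows §2 / §6 / Prop 6.7 / Cor 5.6 (i)), the companion's `layer5_held_cor12` (`Conditional/Layer5OfSData.lean`, Cor 1.2) and this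
module's `layer5_held_ex51v` (Ex 5.1 (v)) / `layer5_held_ex51i_L11` (Ex 5.1 (i), E51/L11) / `layer5_held_sec2_v1` (the §2 rows with
abc-iut-L5-d5's REDUCED binder set, 11 law binders instead of 13; the v0 form inside `layer5_of_S` stays available).  CENSUS v1 (binders inside the conjuncts,
none at top level): CONE 28 (v0) + 21 (Ex 5.1 (v)) + 1 (E51/L11) = 50 law / merge-atom binders (48 on the reduced §2 route: −hcof, −hOutHat) · FACT 1 (F-2571 `MκIsInvariants`) ·
datum side-conditions 8 (v0) — nodes 139 (claim-proved 47 · data 56 · held/pending 36 [conjoined 16 · not typable / settled 20]).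
S-FREE.  Nothing here asserts that abc is proved or refuted or takes a side on [IUTchIII] Cor. 3.12; a binder is an assumption
label; typed ≠ discharged; indexed ≠ endorsed. [cite: Mochizuki2012] [claim: Mochizuki2012, status: disputed] -/
theorem layer5_of_S_v1 :
    Summit.ABC.IUTFork.DAG.PartL5a.StatementOf @layer5_of_S ∧
    Summit.ABC.IUTFork.DAG.PartL5a.StatementOf @layer5_held_cor12 ∧
    Summit.ABC.IUTFork.DAG.PartL5a.StatementOf @layer5_held_ex51v ∧
    Summit.ABC.IUTFork.DAG.PartL5a.StatementOf @layer5_held_ex51i_L11 ∧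
    Summit.ABC.IUTFork.DAG.PartL5a.StatementOf @layer5_held_sec2_v1 :=
  ⟨@layer5_of_S, @layer5_held_cor12, @layer5_held_ex51v, @layer5_held_ex51i_L11, @layer5_held_sec2_v1⟩

end Summit.ABC.IUTFork.Conditional
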